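import Literature.Barriers.CriticalPhenomena.WeaklySAWCouplingFlow
import HarnessLib

/-!
# The flow `ḡ_{j+1} = ḡ_j - β_jḡ_j²`: comparison in `β` and in the initial condition, and the
# massless sums `Σ_l ḡ_lⁿ` ([BBS-rg-flow], Lemma 2.1(i), (ii)(a), (iv))

Continuation of `WeaklySAWCouplingFlow.lean` (theorems only). The remaining elementary clauses of
[BBS-rg-flow, Lemma 2.1] about the sequence `ḡ` (Bauerschmidt–Brydges–Slade, *Structural stability
of a dynamical system near a non-hyperbolic fixed point*, AHP 16 (2015)), which the source
(BBS 2015, §6.1, §7.3, §8.3) uses for the coupling-constant flow of Theorem 4.1, in the setting of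
`GbarHyp` (`0 ≤ β_j ≤ B`, `g₀ > 0`, `Bg₀ ≤ 1/4`) and with explicit constants:
* Lemma 2.1(i), last sentence — "for all `j` and `k`, `ḡ_j` is non-increasing in `β_k`": the
  comparison principle `β ≤ β' ⇒ ḡ(β') ≤ ḡ(β)` (`gbar_le_gbar_of_beta_le`), used in §7.3 of the
  source (Lemma 7.3.1 of the held text, `g̃_j` vs `ḡ_j`);
* Lemma 2.1(iv) — "if `|g̊₀ - ḡ₀| ≤ δg̊₀` then `|g̊_j - ḡ_j| ≤ δg̊_j(1 + O(ḡ₀))` for all `j`": for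
  `β ≥ 0` the factor `1 + O(ḡ₀)` is not needed (`abs_gbar_sub_gbar_le`);
* Lemma 2.1(ii)(a) with `m = 0` in the MASSLESS setting `χ_j ≡ 1` (Assumption (A1) read as
  `β_j ≥ c > 0` for all `j`): `Σ_{l=j}^{j+n-1} ḡ_l² ≤ (ḡ_j - ḡ_{j+n})/c ≤ ḡ_j/c`
  (`sum_gbar_sq_shift_le'`), `Σ_{l=j}^{j+n-1} ḡ_l^{p+2} ≤ ḡ_j^{p+1}/c` (`sum_gbar_pow_shift_le`, the
  case `n > 1` of the lemma), and `Σ_{l=j}^{j+n-1} ḡ_l ≤ log(ḡ_j/ḡ_{j+n})/c` (`sum_gbar_shift_le_log`,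
  the case `n = 1`: "`≤ C|log ḡ_k|`").
(`WeaklySAWQuadraticFlow.lean` proves the `p = 0` square-sum bound under its larger hypothesis
structure `QuadFlowHyp`; the versions here need only `GbarHyp` and `β_j ≥ c`.)

## References
* R. Bauerschmidt, D. C. Brydges, G. Slade, Ann. Henri Poincaré 16 (2015), Lemma 2.1 (i), (ii)(a),
  (iv) and their proofs. [BauerschmidtBrydgesSlade2015Flow]
* R. Bauerschmidt, D. C. Brydges, G. Slade, CMP 337 (2015), §6.1, §7.3 (Lemma 7.3.1 of the held
  text), §8.3 (the bound `Σ_{l=j}^k χ_lḡ_lⁿ ≤ C_n{|log ḡ_k|, χ_jḡ_j^{n-1}}`).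
  [BauerschmidtBrydgesSlade2015LogCorr]
-/

noncomputable section

open Filter Topology Finset
open scoped BigOperators

namespace Literature.Barriers.CriticalPhenomena

namespace CTWSAW

namespace GbarHyp

variable {β β' : ℕ → ℝ} {B c g₀ g₀' : ℝ}

/-! ### Lemma 2.1(i): `ḡ_j` is non-increasing in `β` -/

/-- The map `x ↦ x(1 - tx)` is non-decreasing on `[0, g₀]` when `t ≤ B`, `Bg₀ ≤ 1/4`
(`1 - t(a + b) ≥ 1/2`). [folklore] -/
theorem mul_one_sub_mono {t a b : ℝ} (h : GbarHyp β B g₀) (htB : t ≤ B)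
    (ha0 : 0 ≤ a) (hab : a ≤ b) (hb : b ≤ g₀) : a * (1 - t * a) ≤ b * (1 - t * b) := by
  have h1 : t * (a + b) ≤ 1 / 2 := by
    calc t * (a + b) ≤ B * (g₀ + g₀) :=
          mul_le_mul htB (by linarith) (by linarith) h.B_nonneg
      _ ≤ 1 / 2 := by linarith [h.small]
  nlinarith [mul_nonneg (sub_nonneg.2 hab) (show (0 : ℝ) ≤ 1 - t * (a + b) by linarith)]

/-- **"`ḡ_j` is non-increasing in `β`"**: if `β_j ≤ β'_j` for all `j` (both satisfying `GbarHyp` with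
the same `g₀`), then `ḡ_j(β') ≤ ḡ_j(β)` for all `j`.
[cite: BauerschmidtBrydgesSlade2015Flow, Lemma 2.1(i) (ḡ_j is non-increasing in β_k)] -/
theorem gbar_le_gbar_of_beta_le {B' : ℝ} (h : GbarHyp β B g₀) (h' : GbarHyp β' B' g₀)
    (hle : ∀ j, β j ≤ β' j) (j : ℕ) : gbar β' g₀ j ≤ gbar β g₀ j := by
  induction j with
  | zero => simp
  | succ j ih =>
    rw [gbar_succ', gbar_succ']
    calc gbar β' g₀ j * (1 - β' j * gbar β' g₀ j) ≤ gbar β' g₀ j * (1 - β j * gbar β' g₀ j) := by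
          refine mul_le_mul_of_nonneg_left ?_ (h'.gbar_pos j).le
          nlinarith [hle j, (h'.gbar_pos j).le]
      _ ≤ gbar β g₀ j * (1 - β j * gbar β g₀ j) :=
          mul_one_sub_mono h (h.beta_le j) (h'.gbar_pos j).le ih (h.gbar_le_init j)

/-! ### Lemma 2.1(iv): stability in the initial condition -/

/-- One step of the difference of two solutions with the same `β`:
`g̊_{j+1} - ḡ_{j+1} = (g̊_j - ḡ_j)(1 - β_j(g̊_j + ḡ_j))`. [cite: BauerschmidtBrydgesSlade2015Flow, Lemma 2.1 (proof of (iv), first display)] -/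
theorem gbar_sub_gbar_succ (β : ℕ → ℝ) (g₀ g₀' : ℝ) (j : ℕ) :
    gbar β g₀' (j + 1) - gbar β g₀ (j + 1) =
      (gbar β g₀' j - gbar β g₀ j) * (1 - β j * (gbar β g₀' j + gbar β g₀ j)) := by
  rw [gbar_succ, gbar_succ]; ring

/-- **Lemma 2.1(iv)** (for `β ≥ 0`, without the `1 + O(ḡ₀)` loss): if `|g̊₀ - ḡ₀| ≤ δg̊₀` then
`|g̊_j - ḡ_j| ≤ δg̊_j` for all `j` (`g̊ = ḡ(β, g₀')`, `ḡ = ḡ(β, g₀)`, both under `GbarHyp`).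
[cite: BauerschmidtBrydgesSlade2015Flow, Lemma 2.1(iv)] -/
theorem abs_gbar_sub_gbar_le {δ : ℝ} (h : GbarHyp β B g₀) (h' : GbarHyp β B g₀')
    (h0 : |g₀' - g₀| ≤ δ * g₀') (j : ℕ) :
    |gbar β g₀' j - gbar β g₀ j| ≤ δ * gbar β g₀' j := by
  induction j with
  | zero => simpa using h0
  | succ j ih =>
    have hδ : 0 ≤ δ := by
      by_contra hneg
      have : δ * gbar β g₀' j < 0 := mul_neg_of_neg_of_pos (not_le.1 hneg) (h'.gbar_pos j)
      linarith [abs_nonneg (gbar β g₀' j - gbar β g₀ j)]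
    have hfac0 : 0 ≤ 1 - β j * (gbar β g₀' j + gbar β g₀ j) := by
      nlinarith [h.beta_mul_gbar_le j, h'.beta_mul_gbar_le j]
    rw [gbar_sub_gbar_succ, abs_mul, abs_of_nonneg hfac0, gbar_succ' β g₀' j]
    calc |gbar β g₀' j - gbar β g₀ j| * (1 - β j * (gbar β g₀' j + gbar β g₀ j))
        ≤ δ * gbar β g₀' j * (1 - β j * (gbar β g₀' j + gbar β g₀ j)) :=
          mul_le_mul_of_nonneg_right ih hfac0
      _ ≤ δ * (gbar β g₀' j * (1 - β j * gbar β g₀' j)) := by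
          have := h.beta_mul_gbar_nonneg j
          nlinarith [mul_nonneg hδ (h'.gbar_pos j).le]

/-! ### Lemma 2.1(ii)(a), `m = 0`, massless: the sums `Σ_l ḡ_lⁿ` when `β_j ≥ c > 0` -/

/-- `cḡ_l² ≤ β_lḡ_l² = ḡ_l - ḡ_{l+1}` when `β_l ≥ c`. [cite: BauerschmidtBrydgesSlade2015Flow, Lemma 2.1 (proof of (ii-a): β_lḡ_l² = ḡ_l - ḡ_{l+1})] -/
theorem c_mul_gbar_sq_le' (hc : ∀ j, c ≤ β j) (l : ℕ) :
    c * gbar β g₀ l ^ 2 ≤ gbar β g₀ l - gbar β g₀ (l + 1) := by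
  rw [gbar_succ]
  nlinarith [hc l, sq_nonneg (gbar β g₀ l)]

/-- **`Σ_{l=j}^{j+n-1} ḡ_l² ≤ (ḡ_j - ḡ_{j+n})/c`** (`β_j ≥ c > 0` for all `j`).
[cite: BauerschmidtBrydgesSlade2015Flow, Lemma 2.1(ii)(a) (n = 2, m = 0, χ = 1)] -/
theorem sum_gbar_sq_shift_le' (hcpos : 0 < c) (hc : ∀ j, c ≤ β j) (j n : ℕ) :
    ∑ l ∈ range n, gbar β g₀ (l + j) ^ 2 ≤ (gbar β g₀ j - gbar β g₀ (n + j)) / c := by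
  rw [le_div_iff₀ hcpos, sum_mul]
  calc ∑ l ∈ range n, gbar β g₀ (l + j) ^ 2 * c
      ≤ ∑ l ∈ range n, (gbar β g₀ (l + j) - gbar β g₀ (l + 1 + j)) :=
        sum_le_sum fun l _ => by
          have := c_mul_gbar_sq_le' (g₀ := g₀) hc (l + j)
          rw [Nat.add_right_comm]; linarith
    _ = gbar β g₀ j - gbar β g₀ (n + j) := by
        rw [sum_range_sub' (fun l => gbar β g₀ (l + j))]; simp

/-- **Lemma 2.1(ii)(a), `n > 1`** (massless, `m = 0`): `Σ_{l=j}^{j+n-1} ḡ_l^{p+2} ≤ ḡ_j^{p+1}/c` for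
every `p : ℕ` ("`Σ_{l=j}^k χ_lḡ_lⁿ ≤ C_nχ_jḡ_j^{n-1}`, `n > 1`", with `C_n = 1/c`).
[cite: BauerschmidtBrydgesSlade2015Flow, Lemma 2.1(ii)(a) (n > 1, m = 0, χ = 1)]
[cite: BauerschmidtBrydgesSlade2015LogCorr, §8.3 (the bound Σ_{l=j}^k χ_lḡ_lⁿ ≤ C_nχ_jḡ_j^{n-1}, n > 1)] -/
theorem sum_gbar_pow_shift_le (h : GbarHyp β B g₀) (hcpos : 0 < c) (hc : ∀ j, c ≤ β j)
    (p j n : ℕ) : ∑ l ∈ range n, gbar β g₀ (l + j) ^ (p + 2) ≤ gbar β g₀ j ^ (p + 1) / c := by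
  calc ∑ l ∈ range n, gbar β g₀ (l + j) ^ (p + 2)
      ≤ ∑ l ∈ range n, gbar β g₀ j ^ p * gbar β g₀ (l + j) ^ 2 := sum_le_sum fun l _ => by
        rw [pow_add]
        exact mul_le_mul_of_nonneg_right
          (pow_le_pow_left₀ (h.gbar_pos _).le (h.gbar_antitone (Nat.le_add_left j l)) p)
          (sq_nonneg _)
    _ = gbar β g₀ j ^ p * ∑ l ∈ range n, gbar β g₀ (l + j) ^ 2 := by rw [mul_sum]
    _ ≤ gbar β g₀ j ^ p * (gbar β g₀ j / c) := by
        refine mul_le_mul_of_nonneg_left ((sum_gbar_sq_shift_le' hcpos hc j n).trans ?_)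
          (pow_nonneg (h.gbar_pos j).le p)
        exact div_le_div_of_nonneg_right (by linarith [h.gbar_pos (n + j)]) hcpos.le
    _ = gbar β g₀ j ^ (p + 1) / c := by rw [pow_succ]; ring

/-- **Lemma 2.1(ii)(a), `n = 1`** (massless, `m = 0`): `Σ_{l=j}^{j+n-1} ḡ_l ≤ log(ḡ_j/ḡ_{j+n})/c`
("`Σ_{l=j}^k χ_lḡ_l ≤ C₁|log ḡ_k|`"), from `β_lḡ_l ≤ log(ḡ_l/ḡ_{l+1})`.
[cite: BauerschmidtBrydgesSlade2015Flow, Lemma 2.1(ii)(a) (n = 1, m = 0, χ = 1)]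
[cite: BauerschmidtBrydgesSlade2015LogCorr, §8.3 (the bound Σ_{l=j}^k χ_lḡ_l ≤ C₁|log ḡ_k|)] -/
theorem sum_gbar_shift_le_log (h : GbarHyp β B g₀) (hcpos : 0 < c) (hc : ∀ j, c ≤ β j) (j n : ℕ) :
    ∑ l ∈ range n, gbar β g₀ (l + j) ≤ Real.log (gbar β g₀ j / gbar β g₀ (n + j)) / c := by
  rw [le_div_iff₀ hcpos, sum_mul, Real.log_div (h.gbar_pos j).ne' (h.gbar_pos (n + j)).ne']
  calc ∑ l ∈ range n, gbar β g₀ (l + j) * c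
      ≤ ∑ l ∈ range n, (Real.log (gbar β g₀ (l + j)) - Real.log (gbar β g₀ (l + 1 + j))) :=
        sum_le_sum fun l _ => by
          have h1 := h.beta_mul_gbar_le_log (l + j)
          have h2 : gbar β g₀ (l + j) * c ≤ β (l + j) * gbar β g₀ (l + j) := by
            nlinarith [hc (l + j), (h.gbar_pos (l + j)).le]
          rw [Nat.add_right_comm]; linarith
    _ = Real.log (gbar β g₀ j) - Real.log (gbar β g₀ (n + j)) := by
        rw [sum_range_sub' (fun l => Real.log (gbar β g₀ (l + j)))]; simp

end GbarHyp

end CTWSAW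

end Literature.Barriers.CriticalPhenomena
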